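import Literature.AnabelianGeometry.EtaleTheta.Discharge.Sec5DivisorTransportInducedByOfThm49
import Literature.AnabelianGeometry.EtaleTheta.Discharge.Sec5ThetaDivisorOrbitLiftToRoot

/-!
# [EtTh] §5, Thm. 5.6/5.7: "since `Ψ` [essentially] preserves the divisor of zeroes and poles of `Θ̈`" READ AT THE ROOT PAIR — the ASSEMBLY of GAP-LEDGER G-w5d245-2 (p.329 / PDF p.103)

Mochizuki, *The étale theta function …*, Publ. RIMS **45** (2009): proof of Thm. 5.6, p.329 (PDF p.103) "since `Ψ` [essentially]
preserves the divisor of zeroes and poles of `Θ̈` [cf. Proposition 5.3, (vi)], it follows [cf. the equivalences of categories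
involving pre-steps of [FrdI], Definition 1.3, (iii), (d)] that there exist isomorphisms `γ₁ : S₁ ⥲ T₁`, `γ₂ : S₂ ⥲ T₂`, `u ∈ O^×(T₂)`
such that `γ₂ ∘ s^⊓ = t^⊓ ∘ γ₁`, `u ∘ γ₂ ∘ s^⊔ = t^⊔ ∘ γ₁`"; Prop. 5.3 (vi) p.326 (PDF p.100); p.330 (PDF p.104) "the zero divisor
`Div(s^⊓_N) ∈ Φ(A_N)` … descends … to `Φ(A)`" [cite: MochizukiEtTh2009, Thm 5.6 proof p.329 (PDF p.103); Prop 5.3 (vi) p.326 (PDF p.100)];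
[FrdI] Thm. 4.9, Rem. 1.1.1, Prop. 5.6 [cite: MochizukiFrdI2008, Thm. 4.9 p.88]; [SemiAnbd] Rmk. 3.1.3 [cite: MochizukiSemiAnbd2006, Rmk 3.1.3 p.34].

PROOF-ONLY (0 definitions, no new named fact).  abc-iut cell, layer L2, GAP-LEDGER row **G-w5d245-2** ASSEMBLY (seat abc-iut-w5-d245
gen 4, the row's author; links by abc-iut-w6-d052 (a), abc-iut-w6-d043 (c), abc-iut-f-123 (d)).  For generic §5 data
`𝔉 : ThetaFrobenioid C D`, a self-equivalence `Ψ`, anchors `ι : Ψ(A_⊚) ⥲ A_⊚`, `α : Ψ(A_N) ⥲ A_N` and an arrow `φ : A_N → A_⊚` of `C`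
(at the §5 tower: `α_N ≫ α_l`), the `β`-FREE divisor transport `hdivA` of this seat's seeds producer
(`exists_seeds_div_eq_refl_model`, p445769) — `∃ ε ∈ Aut_C(A_N)`, `Div(α⁻¹ ≫ Ψ(s^⊓_N)) = Div(ε ≫ s^⊓_N)` and
`Div(α⁻¹ ≫ Ψ(s^⊔_N)) = Div(ε ≫ s^⊔_N)` with the SAME `ε` — is DERIVED (`exists_aut_div_transport_eq_of_links`) from:
* LINK (a) — Prop. 5.3's "isomorphism of divisor monoids induced by `Ψ`" read as [FrdI] Thm. 4.9: the stub field `induced` at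
  `T := DivisorTransportStub.ofThm49 𝔉` (abc-iut-w6-d052's `exists_rootPairTransport_natural_of_isInducedBy`: ONE `e_N` transporting both
  root divisors, natural along `A_N → A_⊚`);
* Prop. 5.3 (vi) + (i) at `A_⊚` in SPLIT form (`hsplit`): for some `g ∈ Aut_C(A_⊚)`, `(Ψ^Φ_{A_⊚})^gp Z₀ = g·Z₀` and `(Ψ^Φ_{A_⊚})^gp W₀ = g·W₀`
  for the zero part `Z₀` and the pole part `W₀` of `div(Θ̈) = Z₀·W₀⁻¹` — the OUTPUT of abc-iut-w6-d043's LINK (c)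
  (`psiPhi_eq_pullAut_split…`, `Sec5Prop53ZeroPoleSplit.lean`) applied to `PreservesThetaDivisorOrbit` + `CuspPreserved` (F-2497);
* LINK (b) (`hdesc`, binder until its producer lands): the root divisors DESCEND — `Div(s^⊓_N)^n = φ^* Z₀`, `Div(s^⊔_N)^n = φ^* W₀` in
  `Φ(A_N)^gp` for some `n ≥ 1` (print: `n = l·N`);
* LINK (d) (abc-iut-f-123): the torsor law of the Galois object `A_N^bs` over `A_⊚^bs` in TRANSITIVE form (`hGal`: any two base arrows
  `A_N^bs → A_⊚^bs` differ by `Aut_D(A_N^bs)`, [SemiAnbd] Rmk. 3.1.3) and the section `s^trv_N` (`StrvSection`, [FrdI] Prop. 5.6) —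
  `exists_aut_AN_over_of_strvSection` (lift of `g` INTERTWINING the pull-backs) and `base_map_strv_hom`;
* [FrdI] Rem. 1.1.1 "isomorphisms are isometries" (`hiso`), and the cancellation laws of `Φ(A_N)`: `of : Φ(A_N) → Φ(A_N)^gp` injective
  (`hof`, `Φ` integral) and `n`-th powers injective on `Φ(A_N)^gp` (`htf`, `Φ(A_N)^gp` torsion-free) — [FrdI] Def. 2.4 (i) currency.
MECHANISM: `(α⁻¹)^* ∘ e_N` agrees on `φ^* Z₀`, `φ^* W₀` with pull-back along the automorphism `(e_g⁻¹)^bs ∘ σ` of `A_N^bs`, where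
`σ` moves `φ^bs` to the anchored transport `(α⁻¹ ≫ Ψφ ≫ ι)^bs` and `e_g` lifts `g` along the latter; take `n`-th roots; lift to
`Aut_C(A_N)` by `s^trv_N`.  HONEST FRAMING: kernel-checked implication between typed statements about the §5 data; LINK (b) and the
split form of Prop. 5.3 (vi)(i) are INPUTS here; nothing asserts a result of [EtTh] for an actual curve; typed ≠ discharged; no side
taken on [IUTchIII] Cor. 3.12.
-/

namespace Literature.AnabelianGeometry.EtaleTheta

open CategoryTheory Literature.AlgebraicGeometry.Frobenioids

universe w v v' u u'

namespace ThetaFrobenioid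

variable {C : Type u} [Category.{v} C] {D : Type u'} [Category.{v'} D] (𝔉 : ThetaFrobenioid.{w} C D)

/-- [FrdI] Rem. 1.1.1: `Div(α⁻¹ ≫ ψ) = (α⁻¹)^* Div(ψ) = (pullIso α)⁻¹ (Div ψ)` once isomorphisms are isometries.
[cite: MochizukiFrdI2008, Rem. 1.1.1 p.21] -/
theorem div_iso_inv_comp_eq (hiso : ∀ ⦃X Y : C⦄ (c : X ≅ Y), 𝔉.pre.div c.hom = 1) {Ψ : C ≌ C}
    (α : Ψ.functor.obj 𝔉.AN ≅ 𝔉.AN) {Y : C} (ψ : Ψ.functor.obj 𝔉.AN ⟶ Y) :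
    𝔉.pre.div (α.inv ≫ ψ) = (𝔉.pullIso α).symm (𝔉.pre.div ψ) := by
  have hα : 𝔉.pre.div α.inv = 1 := hiso α.symm
  rw [𝔉.pre.div_comp, hα, one_pow, mul_one]
  rfl

/-- [FrdI] Rem. 1.1.1: `Div(ε ≫ s) = (ε^bs)^* Div(s)` for an automorphism `ε` once isomorphisms are isometries.
[cite: MochizukiFrdI2008, Rem. 1.1.1 p.21] -/
theorem div_iso_hom_comp_eq (hiso : ∀ ⦃X Y : C⦄ (c : X ≅ Y), 𝔉.pre.div c.hom = 1) {X Y : C} (ε : X ≅ X) (s : X ⟶ Y) :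
    𝔉.pre.div (ε.hom ≫ s) = 𝔉.pre.pull (𝔉.base.map ε.hom) (𝔉.pre.div s) := by
  rw [𝔉.pre.div_comp, hiso ε, one_pow, mul_one]

/-- **G-w5d245-2 ASSEMBLED — "Prop. 5.3 (vi) read at the root pair", `β`-free form**: from LINK (a) (`induced` read as [FrdI]
Thm. 4.9), Prop. 5.3 (vi)+(i) at `A_⊚` in split form, LINK (b) (descent of the root divisors along `φ : A_N → A_⊚`), the transitive
torsor law of `A_N^bs` and the section `s^trv_N` (LINK (d)), "isomorphisms are isometries" and the cancellation laws of `Φ(A_N)`: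
there is ONE `ε ∈ Aut_C(A_N)` with `Div(α⁻¹ ≫ Ψ(s^⊓_N)) = Div(ε ≫ s^⊓_N)` and `Div(α⁻¹ ≫ Ψ(s^⊔_N)) = Div(ε ≫ s^⊔_N)` — the binder
`hdivA` of `exists_seeds_div_eq_refl_model` at the anchor `α`.
[cite: MochizukiEtTh2009, Thm 5.6 proof p.329 (PDF p.103); Prop 5.3 (vi) p.326 (PDF p.100)] -/
theorem exists_aut_div_transport_eq_of_links (hiso : ∀ ⦃X Y : C⦄ (c : X ≅ Y), 𝔉.pre.div c.hom = 1)
    (hstrv : 𝔉.StrvSection)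
    (hGal : ∀ a b : 𝔉.base.obj 𝔉.AN ⟶ 𝔉.base.obj 𝔉.Acirc, ∃ σ : Aut (𝔉.base.obj 𝔉.AN), σ.hom ≫ a = b)
    {Ψ : C ≌ C} (ι : Ψ.functor.obj 𝔉.Acirc ≅ 𝔉.Acirc) (α : Ψ.functor.obj 𝔉.AN ≅ 𝔉.AN) (φ : 𝔉.AN ⟶ 𝔉.Acirc)
    {eΦ : 𝔉.PhiAcirc ≃* 𝔉.pre.Mon (𝔉.base.obj (Ψ.functor.obj 𝔉.Acirc))}
    (induced : (FrobenioidThetaDivisors.DivisorTransportStub.ofThm49 𝔉).IsInducedBy Ψ 𝔉.Acirc eΦ)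
    (Z₀ W₀ : Algebra.GrothendieckGroup 𝔉.PhiAcirc)
    (hsplit : ∃ g : Aut 𝔉.Acirc,
      ThetaFrobenioid.gpMap (FrobenioidThetaDivisors.psiPhi 𝔉 Ψ ι eΦ : 𝔉.PhiAcirc →* 𝔉.PhiAcirc) Z₀ =
        ThetaFrobenioid.gpMap (𝔉.pullAut g : 𝔉.PhiAcirc →* 𝔉.PhiAcirc) Z₀ ∧
      ThetaFrobenioid.gpMap (FrobenioidThetaDivisors.psiPhi 𝔉 Ψ ι eΦ : 𝔉.PhiAcirc →* 𝔉.PhiAcirc) W₀ =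
        ThetaFrobenioid.gpMap (𝔉.pullAut g : 𝔉.PhiAcirc →* 𝔉.PhiAcirc) W₀)
    {n : ℕ}
    (hdesc : Algebra.GrothendieckGroup.of (𝔉.pre.div 𝔉.sCap) ^ n = AlgebraicGeometry.Frobenioids.gpMap (𝔉.pre.pull (𝔉.base.map φ)) Z₀ ∧
      Algebra.GrothendieckGroup.of (𝔉.pre.div 𝔉.sCup) ^ n = AlgebraicGeometry.Frobenioids.gpMap (𝔉.pre.pull (𝔉.base.map φ)) W₀)
    (htf : ∀ x y : Algebra.GrothendieckGroup (𝔉.pre.Mon (𝔉.base.obj 𝔉.AN)), x ^ n = y ^ n → x = y)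
    (hof : Function.Injective
      (Algebra.GrothendieckGroup.of : 𝔉.pre.Mon (𝔉.base.obj 𝔉.AN) → Algebra.GrothendieckGroup (𝔉.pre.Mon (𝔉.base.obj 𝔉.AN)))) :
    ∃ ε : Aut 𝔉.AN,
      𝔉.pre.div (α.inv ≫ Ψ.functor.map 𝔉.sCap) = 𝔉.pre.div (ε.hom ≫ 𝔉.sCap) ∧
      𝔉.pre.div (α.inv ≫ Ψ.functor.map 𝔉.sCup) = 𝔉.pre.div (ε.hom ≫ 𝔉.sCup) := by
  -- LINK (a): one `e_N` transporting both root divisors, natural along `φ`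
  obtain ⟨eN, hcap, hcup, hnat, -⟩ := FrobenioidThetaDivisors.exists_rootPairTransport_natural_of_isInducedBy 𝔉 induced
  obtain ⟨g, hgZ, hgW⟩ := hsplit
  -- the anchored transport of `φ` and a base automorphism `σ` moving `φ^bs` to it ([SemiAnbd] Rmk. 3.1.3, transitive form)
  obtain ⟨σ, hσ⟩ := hGal (𝔉.base.map φ) (𝔉.base.map (α.inv ≫ Ψ.functor.map φ ≫ ι.hom))
  -- LINK (d): `g` lifts along the anchored transport, intertwining the pull-backs
  have hGal' : ∀ (a : 𝔉.base.obj 𝔉.AN ⟶ 𝔉.base.obj 𝔉.Acirc) (t : 𝔉.base.obj 𝔉.Acirc ⟶ 𝔉.base.obj 𝔉.Acirc),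
      ∃ τ : Aut (𝔉.base.obj 𝔉.AN), τ.hom ≫ a = a ≫ t := fun a t => hGal a (a ≫ t)
  obtain ⟨e, -, -, hint⟩ := exists_aut_AN_over_of_strvSection hstrv hGal' (𝔉.base.map (α.inv ≫ Ψ.functor.map φ ≫ ι.hom)) g
  -- the composite `T := (α⁻¹)^* ∘ e_N : Φ(A_N) → Φ(A_N)` and its value on `φ^* x`
  have hT : ∀ x : 𝔉.PhiAcirc,
      (𝔉.pullIso α).symm (eN (𝔉.pre.pull (𝔉.base.map φ) x)) =
        𝔉.pre.pull (𝔉.base.map (α.inv ≫ Ψ.functor.map φ ≫ ι.hom)) (FrobenioidThetaDivisors.psiPhi 𝔉 Ψ ι eΦ x) := by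
    intro x
    rw [hnat]
    change 𝔉.pre.pull (𝔉.base.map α.inv) (𝔉.pre.pull (𝔉.base.map (Ψ.functor.map φ)) (eΦ x)) =
      𝔉.pre.pull (𝔉.base.map (α.inv ≫ Ψ.functor.map φ ≫ ι.hom)) (𝔉.pre.pull (𝔉.base.map ι.inv) (eΦ x))
    rw [← 𝔉.pre.pull_comp, ← 𝔉.pre.pull_comp, ← Functor.map_comp, ← Functor.map_comp, Category.assoc, Category.assoc,
      ι.hom_inv_id, Category.comp_id]
  -- as an identity of homomorphisms `Φ(A_⊚) → Φ(A_N)`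
  have hTcomp : ((𝔉.pullIso α).symm.toMonoidHom.comp eN.toMonoidHom).comp (𝔉.pre.pull (𝔉.base.map φ)) =
      (𝔉.pre.pull (𝔉.base.map (α.inv ≫ Ψ.functor.map φ ≫ ι.hom))).comp
        (FrobenioidThetaDivisors.psiPhi 𝔉 Ψ ι eΦ : 𝔉.PhiAcirc →* 𝔉.PhiAcirc) :=
    MonoidHom.ext fun x => hT x
  -- `φ'^* = σ^* ∘ φ^*`
  have hσcomp : 𝔉.pre.pull (𝔉.base.map (α.inv ≫ Ψ.functor.map φ ≫ ι.hom)) =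
      (𝔉.pre.pull σ.hom).comp (𝔉.pre.pull (𝔉.base.map φ)) := by
    refine MonoidHom.ext fun x => ?_
    rw [← hσ, 𝔉.pre.pull_comp]
    rfl
  -- the key identity on `Φ(A_N)^gp`, for each part `X₀ ∈ {Z₀, W₀}` with its descent `d ^ n = φ^* X₀`
  have key : ∀ (d : 𝔉.pre.Mon (𝔉.base.obj 𝔉.AN)) (X₀ : Algebra.GrothendieckGroup 𝔉.PhiAcirc),
      Algebra.GrothendieckGroup.of d ^ n = AlgebraicGeometry.Frobenioids.gpMap (𝔉.pre.pull (𝔉.base.map φ)) X₀ →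
      ThetaFrobenioid.gpMap (FrobenioidThetaDivisors.psiPhi 𝔉 Ψ ι eΦ : 𝔉.PhiAcirc →* 𝔉.PhiAcirc) X₀ =
        ThetaFrobenioid.gpMap (𝔉.pullAut g : 𝔉.PhiAcirc →* 𝔉.PhiAcirc) X₀ →
      (𝔉.pullIso α).symm (eN d) = 𝔉.pre.pull (𝔉.base.map e.inv ≫ σ.hom) d := by
    intro d X₀ hd hgX
    apply hof
    apply htf
    -- left-hand side: `of ((α⁻¹)^* e_N d) ^ n = ((α⁻¹)^* ∘ e_N)^gp (φ^* X₀) = (φ'^*)^gp ((Ψ^Φ)^gp X₀)`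
    have h1 : Algebra.GrothendieckGroup.of ((𝔉.pullIso α).symm (eN d)) ^ n =
        AlgebraicGeometry.Frobenioids.gpMap (𝔉.pre.pull (𝔉.base.map (α.inv ≫ Ψ.functor.map φ ≫ ι.hom)))
          (AlgebraicGeometry.Frobenioids.gpMap (FrobenioidThetaDivisors.psiPhi 𝔉 Ψ ι eΦ : 𝔉.PhiAcirc →* 𝔉.PhiAcirc) X₀) := by
      have h1a : Algebra.GrothendieckGroup.of ((𝔉.pullIso α).symm (eN d)) =
          AlgebraicGeometry.Frobenioids.gpMap ((𝔉.pullIso α).symm.toMonoidHom.comp eN.toMonoidHom) (Algebra.GrothendieckGroup.of d) := by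
        rw [AlgebraicGeometry.Frobenioids.gpMap_of]; rfl
      rw [h1a, ← map_pow, hd, ← MonoidHom.comp_apply, ← AlgebraicGeometry.Frobenioids.gpMap_comp,
        ← MonoidHom.comp_apply (AlgebraicGeometry.Frobenioids.gpMap _) (AlgebraicGeometry.Frobenioids.gpMap _),
        ← AlgebraicGeometry.Frobenioids.gpMap_comp, hTcomp]
    -- right-hand side: `of ((e⁻¹)^bs σ)^* d) ^ n = (e ·)^gp (σ^*)^gp (φ^* X₀)`
    have h2 : Algebra.GrothendieckGroup.of (𝔉.pre.pull (𝔉.base.map e.inv ≫ σ.hom) d) ^ n =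
        ThetaFrobenioid.gpMap (𝔉.pullAut e : 𝔉.pre.Mon (𝔉.base.obj 𝔉.AN) →* 𝔉.pre.Mon (𝔉.base.obj 𝔉.AN))
          (AlgebraicGeometry.Frobenioids.gpMap (𝔉.pre.pull σ.hom) (AlgebraicGeometry.Frobenioids.gpMap (𝔉.pre.pull (𝔉.base.map φ)) X₀)) := by
      have h2a : Algebra.GrothendieckGroup.of (𝔉.pre.pull (𝔉.base.map e.inv ≫ σ.hom) d) =
          AlgebraicGeometry.Frobenioids.gpMap ((𝔉.pullAut e : 𝔉.pre.Mon (𝔉.base.obj 𝔉.AN) →* 𝔉.pre.Mon (𝔉.base.obj 𝔉.AN)).comp (𝔉.pre.pull σ.hom))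
            (Algebra.GrothendieckGroup.of d) := by
        rw [AlgebraicGeometry.Frobenioids.gpMap_of, MonoidHom.comp_apply, coe_pullAut, 𝔉.pre.pull_comp]
      rw [h2a, ← map_pow, hd, AlgebraicGeometry.Frobenioids.gpMap_comp, MonoidHom.comp_apply, gpMap_eq_gpMap]
    rw [h1, h2, ← gpMap_eq_gpMap (FrobenioidThetaDivisors.psiPhi 𝔉 Ψ ι eΦ : 𝔉.PhiAcirc →* 𝔉.PhiAcirc), hgX, hint X₀,
      hσcomp, AlgebraicGeometry.Frobenioids.gpMap_comp, MonoidHom.comp_apply]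
  -- the automorphism `ε := e⁻¹ ≫ s^trv_N(σ)` of `A_N`, with `ε^bs = (e⁻¹)^bs ≫ σ`
  refine ⟨e.symm ≪≫ 𝔉.strv σ, ?_, ?_⟩
  · rw [div_iso_inv_comp_eq 𝔉 hiso α, hcap, div_iso_hom_comp_eq 𝔉 hiso, Iso.trans_hom, Iso.symm_hom, Functor.map_comp,
      base_map_strv_hom hstrv]
    exact key _ Z₀ hdesc.1 hgZ
  · rw [div_iso_inv_comp_eq 𝔉 hiso α, hcup, div_iso_hom_comp_eq 𝔉 hiso, Iso.trans_hom, Iso.symm_hom, Functor.map_comp,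
      base_map_strv_hom hstrv]
    exact key _ W₀ hdesc.2 hgW

end ThetaFrobenioid

end Literature.AnabelianGeometry.EtaleTheta
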